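import Summits.CriticalPhenomena.CardyFormulaZ2.Theorems.CardySelfDualSegmentUniformMarginalityStubRussoIdentity

/-!
# `RussoBound` in the large-mesh regime (line `Sketch`, crux `UniformMarginality`, stmt-CriticalPhenomena-5472)

Helper toward the lead's stub `stub_russoBound` (`RussoBound`: a bound on `∂_t P_t(R,δ)`
locally in `t`, UNIFORMLY in the mesh `δ`). This file settles the trivial half: for meshes
bounded BELOW, `δ ≥ δ₁ > 0`, the Russo sum of `stub_russoIdentity` has at most `#Y(R, δ₁)`
non-zero terms, each of modulus `≤ 1`, where `Y(R, δ₁)` is the finite set of vertices whose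
`δ₁ √2`-mesh point lies in a ball containing the (bounded) carrier; hence
`|∂_t P_t(R,δ)| ≤ #Y / 2` for all `t ∈ (0,1)` and all `δ ≥ δ₁` (`russoBound_largeMesh`).
Consequently `RussoBound` is EQUIVALENT to its small-mesh form (`russoBound_iff_smallMesh`):
the whole content of the stub is the regime `δ → 0⁺`.
-/

noncomputable section

namespace Summit.CriticalPhenomena.CardyFormulaZ2.Cruxes.UniformMarginality.HeatFlow

open MeasureTheory Literature.Probability.Percolation Literature.Probability.LatticeModels
  Literature.Probability.RandomPlanarGeometry

/-- Each Russo term has modulus at most `1`: `|E_t[X_v]| ≤ 1` since `|X_v| ≤ 1` and `M_t` is a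
probability measure. -/
theorem abs_integral_russoIntegrand_le_one (A : Set (BondConfig (Site 2))) (v : Site 2) (s : ℝ) :
    |∫ ω, russoIntegrand A v ω ∂(M s)| ≤ 1 := by
  have hb : ∀ ω, ‖russoIntegrand A v ω‖ ≤ 1 := by
    intro ω
    unfold russoIntegrand
    rw [Real.norm_eq_abs, abs_mul]
    refine mul_le_one₀ ?_ (abs_nonneg _) ?_
    · split_ifs <;> simp
    · split_ifs <;> simp
  haveI : IsProbabilityMeasure (M s) := by unfold M; infer_instance
  have h := norm_integral_le_of_norm_le_const (μ := M s) (Filter.Eventually.of_forall hb)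
  rw [Real.norm_eq_abs] at h
  simpa using h

/-- Outside `verts R δ` the Russo term vanishes identically (`δ > 0`): the north edge of such a
vertex is never pivotal. -/
theorem integral_russoIntegrand_eq_zero (R : ConformalRectangle) {δ : ℝ} (hδ : 0 < δ) {v : Site 2}
    (hv : v ∉ (verts_finite R hδ).toFinset) (s : ℝ) :
    ∫ ω, russoIntegrand (crossEvent R δ) v ω ∂(M s) = 0 := by
  have h0 : ∀ ω, russoIntegrand (crossEvent R δ) v ω = 0 := by
    intro ω
    unfold russoIntegrand
    rw [if_neg (not_isPivotal_northEdge R hδ hv ω), mul_zero]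
  simp [h0]

/-- The finite set of vertices that can matter at any mesh `δ ≥ δ₁`: those whose `δ₁ √2`-mesh
point lies in the closed ball of radius `r` about `0`. -/
theorem verts_subset_of_le (R : ConformalRectangle) {r : ℝ}
    (hr : R.carrier ⊆ Metric.closedBall (0 : ℂ) r) {δ₁ δ : ℝ} (hδ₁ : 0 < δ₁) (hle : δ₁ ≤ δ) :
    verts R δ ⊆ meshVertices (Metric.closedBall (0 : ℂ) r) (δ₁ * Real.sqrt 2) := by
  intro x hx
  rw [verts_eq_meshVertices, mem_meshVertices_iff] at hx
  rw [mem_meshVertices_iff, Metric.mem_closedBall, dist_zero_right]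
  have hx' : ‖meshPoint (δ * Real.sqrt 2) x‖ ≤ r := by
    have := hr hx
    rwa [Metric.mem_closedBall, dist_zero_right] at this
  have hδ : 0 < δ := lt_of_lt_of_le hδ₁ hle
  -- `meshPoint c x = c · x`, so the norms scale by `δ₁ / δ ≤ 1`
  have hscale : meshPoint (δ₁ * Real.sqrt 2) x =
      ((δ₁ / δ : ℝ) : ℂ) * meshPoint (δ * Real.sqrt 2) x := by
    simp only [meshPoint, ← mul_assoc, ← Complex.ofReal_mul]
    congr 2
    field_simp
  rw [hscale, norm_mul, Complex.norm_real, Real.norm_eq_abs, abs_of_pos (div_pos hδ₁ hδ)]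
  calc δ₁ / δ * ‖meshPoint (δ * Real.sqrt 2) x‖ ≤ 1 * ‖meshPoint (δ * Real.sqrt 2) x‖ := by
        refine mul_le_mul_of_nonneg_right ?_ (norm_nonneg _)
        rw [div_le_one hδ]; exact hle
    _ = ‖meshPoint (δ * Real.sqrt 2) x‖ := one_mul _
    _ ≤ r := hx'

/-- **`RussoBound` in the large-mesh regime.** For every conformal rectangle `R` and every
`δ₁ > 0` there is `C` with `|∂_t P_t(R,δ)| ≤ C` for all `t ∈ (0,1)` and ALL `δ ≥ δ₁`
(by `stub_russoIdentity`: at most `#Y` non-zero Russo terms of modulus `≤ 1`). -/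
theorem russoBound_largeMesh :
    ∀ (R : ConformalRectangle) (δ₁ : ℝ), 0 < δ₁ →
      ∃ C : ℝ, ∀ δ : ℝ, δ₁ ≤ δ → ∀ t ∈ Set.Ioo (0 : ℝ) 1, |deriv (Pext R δ) t| ≤ C := by
  classical
  intro R δ₁ hδ₁
  obtain ⟨r, hr⟩ := (Metric.isBounded_iff_subset_closedBall (0 : ℂ)).1 R.isBounded
  have hYfin : (meshVertices (Metric.closedBall (0 : ℂ) r) (δ₁ * Real.sqrt 2)).Finite :=
    meshVertices_finite Metric.isBounded_closedBall (mul_pos hδ₁ (Real.sqrt_pos.2 two_pos))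
  refine ⟨(1 / 2 : ℝ) * hYfin.toFinset.card, fun δ hle t ht => ?_⟩
  have hδ : 0 < δ := lt_of_lt_of_le hδ₁ hle
  obtain ⟨K, -, hderiv⟩ := stub_russoIdentity R δ hδ
  rw [(hderiv t ht).deriv, abs_mul, abs_of_pos (by norm_num : (0 : ℝ) < 1 / 2)]
  refine mul_le_mul_of_nonneg_left ?_ (by norm_num)
  -- split the Russo sum over `K ∩ Y` and `K \ Y`; the latter terms vanish
  have hsplit : ∑ v ∈ K, ∫ ω, russoIntegrand (crossEvent R δ) v ω ∂(M t) =
      ∑ v ∈ K.filter (fun v => v ∈ hYfin.toFinset),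
        ∫ ω, russoIntegrand (crossEvent R δ) v ω ∂(M t) := by
    rw [Finset.sum_filter]
    refine Finset.sum_congr rfl fun v _ => ?_
    split_ifs with hvY
    · rfl
    · refine integral_russoIntegrand_eq_zero R hδ (fun hv => hvY ?_) t
      rw [Set.Finite.mem_toFinset] at hv ⊢
      exact verts_subset_of_le R hr hδ₁ hle hv
  rw [hsplit]
  calc |∑ v ∈ K.filter (fun v => v ∈ hYfin.toFinset), ∫ ω, russoIntegrand (crossEvent R δ) v ω ∂(M t)|
      ≤ ∑ v ∈ K.filter (fun v => v ∈ hYfin.toFinset),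
          |∫ ω, russoIntegrand (crossEvent R δ) v ω ∂(M t)| := Finset.abs_sum_le_sum_abs _ _
    _ ≤ ∑ v ∈ K.filter (fun v => v ∈ hYfin.toFinset), (1 : ℝ) :=
        Finset.sum_le_sum fun v _ => abs_integral_russoIntegrand_le_one _ v t
    _ = ((K.filter (fun v => v ∈ hYfin.toFinset)).card : ℝ) := by simp
    _ ≤ (hYfin.toFinset.card : ℝ) := by
        exact_mod_cast Finset.card_le_card (fun v hv => (Finset.mem_filter.1 hv).2)

/-- **Small-mesh form of `RussoBound`**: the bound is only asked for meshes below some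
`δ₁(R, t₀) > 0`. -/
def RussoBoundSmallMesh : Prop :=
  ∀ (R : ConformalRectangle) (t₀ : ℝ), t₀ ∈ Set.Icc (0 : ℝ) 1 → ∃ η > 0, ∃ δ₁ > 0, ∃ C : ℝ,
    ∀ δ : ℝ, 0 < δ → δ < δ₁ → ∀ t ∈ Set.Ioo (0 : ℝ) 1, |t - t₀| < η → |deriv (Pext R δ) t| ≤ C

/-- **`RussoBound` is equivalent to its small-mesh form**: the large-mesh regime is free
(`russoBound_largeMesh`), so the research content of the stub is exactly the regime `δ → 0⁺`. -/
theorem russoBound_iff_smallMesh : RussoBound ↔ RussoBoundSmallMesh := by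
  constructor
  · intro h R t₀ ht₀
    obtain ⟨η, hη, C, hC⟩ := h R t₀ ht₀
    exact ⟨η, hη, 1, one_pos, C, fun δ hδ _ t ht htt₀ => hC δ hδ t ht htt₀⟩
  · intro h R t₀ ht₀
    obtain ⟨η, hη, δ₁, hδ₁, C, hC⟩ := h R t₀ ht₀
    obtain ⟨C', hC'⟩ := russoBound_largeMesh R δ₁ hδ₁
    refine ⟨η, hη, max C C', fun δ hδ t ht htt₀ => ?_⟩
    rcases lt_or_ge δ δ₁ with hlt | hge
    · exact (hC δ hδ hlt t ht htt₀).trans (le_max_left _ _)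
    · exact (hC' δ hge t ht).trans (le_max_right _ _)

end Summit.CriticalPhenomena.CardyFormulaZ2.Cruxes.UniformMarginality.HeatFlow

end
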